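import Literature.MathematicalPhysics.StatisticalMechanics.Theil2006DistanceSet
import Mathlib.GroupTheory.Index
import Mathlib.Data.ZMod.QuotientGroup
import HarnessLib

/-!
# Theil 2006, (21) and Appendix p. 25: the `m(λ) λ²` classes of equilateral lattice triangles

Topic `Literature/MathematicalPhysics/StatisticalMechanics`; companion of `Theil2006.lean`
(F. Theil, *A proof of crystallization in two dimensions*, Comm. Math. Phys. **262** (2006)
209–236, accepted preprint of 26 Aug 2005), §2.3 display (21) (p. 8) and the Appendix proof of
Proposition 2.9 (27), display (72) (p. 25).

## Source, as printed, and what this file provides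

(21): «`m(λ) = ⅙ #(A₂ ∩ {|η| = λ})` is the number of different `D₆`-invariant sub-lattices of `A₂`
with lattice parameter `λ` divided by `λ²`» (the tree: `Theil2006.m`, `Theil2006.shell`,
`Theil2006.m_eq_card_sector`).  (72), proof: «Note that `n(S, λ) ≤ λ² m(λ)` and
`n(S, λ) = λ² m(λ)` if `dist(y(S), y(∂X)) > 28λ`.  (Indeed, there are precisely `6 m(λ)` sets
`{η₁, η₂, η₃} ⊂ A₂` which have the property `|η_i − η_j| = λ` …)».

The measure-weighted count `n(S, λ)` is governed not by corners but by CLASSES: an equilateral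
triangle of side `λ` with vertices in `A₂ = ℤ[ω]` (`ω = e^{iπ/3}`; labels `ℤ²`, `b₁ = 1`,
`b₂ = ω`) is a unit triangle of exactly one translated sub-lattice `ξ + η ℤ[ω]`, `|η| = λ`; there are
`m(λ)` sub-lattices `η ℤ[ω]` (one per `η ∈ shell(λ)` modulo the six units) and each has `λ²`
cosets.  This file is the lattice arithmetic behind that count:

* `Theil2006.emul`, `econj`, `normForm` — the Eisenstein product, conjugation and norm on labels;
  `normForm_emul` (multiplicativity), `norm_triPoint_emul` (`|ηζ| = |η||ζ|`), `rotN_eq_emul`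
  (the tree's rotations `rotN j` are multiplication by the units `unitVec j`);
* `Theil2006.subl η` — the sub-lattice `η ℤ[ω]` as an `AddSubgroup (ℤ × ℤ)`; **`index_subl`: its
  index is `N(η) = |η|²`** (multiplication by `η` carries `η̄ ℤ[ω]` onto `N(η) ℤ[ω] = Nℤ × Nℤ`);
* `Theil2006.rep` — sector representatives modulo units; `Theil2006.ClassIdx λ` — the index type of
  classes (`η ∈ shell λ ∩ sector`, coset in `ℤ² ⧸ η ℤ[ω]`), **`natCard_classIdx`:
  `#ClassIdx λ = m(λ) λ²`**; `cosetOf`, distances inside a coset (`dist_trichotomy`: `0`, `λ`, or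
  `≥ √3 λ`; the six neighbours `g + R^j η`);
* `Theil2006.classOf` — the class of a lattice edge of length `λ`; `third_mem_cosetOf_classOf` (an
  equilateral lattice triangle lies in the class of any of its edges, via `eq_rotN_of_normForm_eq`);
  `classIdx_eq_of_edge` (different classes share no edge); `exists_mem_cosetOf_dist_lt` (every
  coset is `λ`-dense).

Used by `Theil2006CoarseTiling.lean` / `Theil2006MeasureBookkeeping.lean` to prove (72).
Everything here is proved; no named facts.
-/
noncomputable section

namespace Literature.MathematicalPhysics.StatisticalMechanics

namespace Theil2006

open Set Metric

/-! ### Eisenstein arithmetic on the labels `ℤ²` of `A₂` -/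

/-- The norm form `k₁² + k₁k₂ + k₂²` of `A₂` (`= |triPoint k|²`, `Theil2006.norm_triPoint_sq`), as an
integer. [cite: Theil2006, §2.3 (21) (preprint p. 8)] -/
def normForm (k : ℤ × ℤ) : ℤ := k.1 ^ 2 + k.1 * k.2 + k.2 ^ 2

/-- The Eisenstein product on labels: `(a + bω)(c + dω) = (ac − bd) + (ad + bc + bd)ω`
(`ω = e^{iπ/3}`, `ω² = ω − 1`; `b₁ = 1`, `b₂ = ω`). [cite: Theil2006, §2.3 (21) (preprint p. 8); our lemma] -/
def emul (η ζ : ℤ × ℤ) : ℤ × ℤ := (η.1 * ζ.1 - η.2 * ζ.2, η.1 * ζ.2 + η.2 * ζ.1 + η.2 * ζ.2)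

/-- Complex conjugation on labels: `a + bω ↦ a + bω̄ = (a + b) − bω`. [cite: Theil2006, §2.3 (21) (preprint p. 8); our lemma] -/
def econj (k : ℤ × ℤ) : ℤ × ℤ := (k.1 + k.2, -k.2)

/-- `|triPoint k|² = normForm k`. [cite: Theil2006, §2.3 (21) (preprint p. 8)] -/
theorem norm_triPoint_sq_eq_normForm (k : ℤ × ℤ) : ‖triPoint k‖ ^ 2 = (normForm k : ℝ) := by
  rw [norm_triPoint_sq, normForm]

/-- The norm form is non-negative. [cite: Theil2006, §2.3 (21) (preprint p. 8); our lemma] -/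
theorem normForm_nonneg (k : ℤ × ℤ) : 0 ≤ normForm k := by
  unfold normForm; nlinarith [sq_nonneg (2 * k.1 + k.2), sq_nonneg k.2]

/-- The norm form vanishes only at the origin. [cite: Theil2006, §2.3 (21) (preprint p. 8); our lemma] -/
theorem normForm_eq_zero_iff {k : ℤ × ℤ} : normForm k = 0 ↔ k = 0 := by
  constructor
  · intro h
    by_contra hk
    have := one_le_normForm hk
    rw [normForm] at h
    omega
  · rintro rfl
    simp [normForm]

/-- The norm form is positive off the origin. [cite: Theil2006, §2.3 (21) (preprint p. 8); our lemma] -/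
theorem normForm_pos {k : ℤ × ℤ} (hk : k ≠ 0) : 0 < normForm k :=
  lt_of_le_of_ne (normForm_nonneg k) fun h => hk (normForm_eq_zero_iff.1 h.symm)

/-- The Eisenstein product is commutative. [cite: Theil2006, §2.3 (21) (preprint p. 8); our lemma] -/
theorem emul_comm (η ζ : ℤ × ℤ) : emul η ζ = emul ζ η := by
  unfold emul; ext <;> ring

/-- The Eisenstein product is associative. [cite: Theil2006, §2.3 (21) (preprint p. 8); our lemma] -/
theorem emul_assoc (a b c : ℤ × ℤ) : emul (emul a b) c = emul a (emul b c) := by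
  unfold emul; ext <;> simp only <;> ring

/-- Left-nested products re-associate: `a (b c) = (a b) c`. [cite: Theil2006, §2.3 (21) (preprint p. 8); our lemma] -/
theorem emul_emul (a b c : ℤ × ℤ) : emul a (emul b c) = emul (emul a b) c := (emul_assoc a b c).symm

/-- Additivity in the second factor. [cite: Theil2006, §2.3 (21) (preprint p. 8); our lemma] -/
theorem emul_add (η a b : ℤ × ℤ) : emul η (a + b) = emul η a + emul η b := by
  unfold emul; ext <;> simp only [Prod.fst_add, Prod.snd_add] <;> ring

/-- `η · 0 = 0`. [cite: Theil2006, §2.3 (21) (preprint p. 8); our lemma] -/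
@[simp] theorem emul_zero (η : ℤ × ℤ) : emul η 0 = 0 := by
  unfold emul; simp

/-- Negation in the second factor. [cite: Theil2006, §2.3 (21) (preprint p. 8); our lemma] -/
theorem emul_neg (η a : ℤ × ℤ) : emul η (-a) = -emul η a := by
  unfold emul; ext <;> simp only [Prod.fst_neg, Prod.snd_neg] <;> ring

/-- Subtraction in the second factor. [cite: Theil2006, §2.3 (21) (preprint p. 8); our lemma] -/
theorem emul_sub (η a b : ℤ × ℤ) : emul η (a - b) = emul η a - emul η b := by
  rw [sub_eq_add_neg, emul_add, emul_neg, ← sub_eq_add_neg]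

/-- Integer scalars in the second factor. [cite: Theil2006, §2.3 (21) (preprint p. 8); our lemma] -/
theorem emul_zsmul (η : ℤ × ℤ) (n : ℤ) (a : ℤ × ℤ) : emul η (n • a) = n • emul η a := by
  unfold emul; ext <;> simp only [Prod.smul_fst, Prod.smul_snd, smul_eq_mul] <;> ring

/-- The unit `1 = (1, 0)`. [cite: Theil2006, §2.3 (21) (preprint p. 8); our lemma] -/
@[simp] theorem emul_one (η : ℤ × ℤ) : emul η (1, 0) = η := by
  unfold emul; ext <;> simp

/-- `(1, 0)` is a left unit. [cite: Theil2006, §2.3 (21) (preprint p. 8); our lemma] -/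
@[simp] theorem one_emul (ζ : ℤ × ℤ) : emul (1, 0) ζ = ζ := by
  rw [emul_comm, emul_one]

/-- Multiplication by a natural number `n = (n, 0)` is the scalar action. [cite: Theil2006, §2.3 (21) (preprint p. 8); our lemma] -/
theorem emul_intCast (n : ℤ) (ζ : ℤ × ℤ) : emul (n, 0) ζ = n • ζ := by
  unfold emul; ext <;> simp

/-- **The norm form is multiplicative.** [cite: Theil2006, §2.3 (21) (preprint p. 8); our lemma] -/
theorem normForm_emul (η ζ : ℤ × ℤ) : normForm (emul η ζ) = normForm η * normForm ζ := by
  unfold normForm emul; ring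

/-- `η η̄ = N(η)`. [cite: Theil2006, §2.3 (21) (preprint p. 8); our lemma] -/
theorem emul_econj (η : ℤ × ℤ) : emul η (econj η) = (normForm η, 0) := by
  unfold emul econj normForm; ext <;> simp only <;> ring

/-- Conjugation is an involution. [cite: Theil2006, §2.3 (21) (preprint p. 8); our lemma] -/
@[simp] theorem econj_econj (k : ℤ × ℤ) : econj (econj k) = k := by
  unfold econj; ext <;> simp

/-- Conjugation is additive. [cite: Theil2006, §2.3 (21) (preprint p. 8); our lemma] -/
theorem econj_add (a b : ℤ × ℤ) : econj (a + b) = econj a + econj b := by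
  unfold econj; ext <;> simp only [Prod.fst_add, Prod.snd_add] <;> ring

/-- Conjugation is multiplicative. [cite: Theil2006, §2.3 (21) (preprint p. 8); our lemma] -/
theorem econj_emul (η ζ : ℤ × ℤ) : econj (emul η ζ) = emul (econj η) (econj ζ) := by
  unfold econj emul; ext <;> simp only <;> ring

/-- The Eisenstein product as an additive monoid homomorphism in the second factor. [cite: Theil2006, §2.3 (21) (preprint p. 8); our lemma] -/
def emulHom (η : ℤ × ℤ) : ℤ × ℤ →+ ℤ × ℤ where
  toFun := emul η
  map_zero' := emul_zero η
  map_add' := emul_add η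

/-- `emulHom η` is `emul η`. [cite: Theil2006, §2.3 (21) (preprint p. 8); our lemma] -/
@[simp] theorem emulHom_apply (η ζ : ℤ × ℤ) : emulHom η ζ = emul η ζ := rfl

/-- Conjugation as an additive automorphism of `ℤ²`. [cite: Theil2006, §2.3 (21) (preprint p. 8); our lemma] -/
def econjEquiv : ℤ × ℤ ≃+ ℤ × ℤ where
  toFun := econj
  invFun := econj
  left_inv := econj_econj
  right_inv := econj_econj
  map_add' := econj_add

/-- `econjEquiv` is `econj`. [cite: Theil2006, §2.3 (21) (preprint p. 8); our lemma] -/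
@[simp] theorem econjEquiv_apply (k : ℤ × ℤ) : econjEquiv k = econj k := rfl

/-- `ℤ[ω]` is a domain: `η ζ = 0 ⇒ η = 0 ∨ ζ = 0`. [cite: Theil2006, §2.3 (21) (preprint p. 8); our lemma] -/
theorem emul_eq_zero_iff {η ζ : ℤ × ℤ} : emul η ζ = 0 ↔ η = 0 ∨ ζ = 0 := by
  constructor
  · intro h
    have h1 : normForm (emul η ζ) = 0 := by rw [h]; simp [normForm]
    rw [normForm_emul, mul_eq_zero, normForm_eq_zero_iff, normForm_eq_zero_iff] at h1
    exact h1
  · rintro (rfl | rfl)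
    · rw [emul_comm]; exact emul_zero _
    · exact emul_zero _

/-- Multiplication by `η ≠ 0` is injective. [cite: Theil2006, §2.3 (21) (preprint p. 8); our lemma] -/
theorem emul_injective {η : ℤ × ℤ} (hη : η ≠ 0) : Function.Injective (emul η) := by
  intro a b h
  have h1 : emul η (a - b) = 0 := by rw [emul_sub, h, sub_self]
  rcases emul_eq_zero_iff.1 h1 with h2 | h2
  · exact absurd h2 hη
  · exact sub_eq_zero.1 h2

/-- **`|η ζ| = |η| |ζ|`** for the lattice vectors. [cite: Theil2006, §2.3 (21) (preprint p. 8); our lemma] -/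
theorem norm_triPoint_emul (η ζ : ℤ × ℤ) :
    ‖triPoint (emul η ζ)‖ = ‖triPoint η‖ * ‖triPoint ζ‖ := by
  have h : ‖triPoint (emul η ζ)‖ ^ 2 = (‖triPoint η‖ * ‖triPoint ζ‖) ^ 2 := by
    rw [mul_pow, norm_triPoint_sq_eq_normForm, norm_triPoint_sq_eq_normForm,
      norm_triPoint_sq_eq_normForm, normForm_emul]
    push_cast; ring
  exact (pow_left_inj₀ (norm_nonneg _) (by positivity) two_ne_zero).1 h

/-- Integer multiples scale the norm: `|n k| = |n| |k|`. [cite: Theil2006, §2.3 (21) (preprint p. 8); our lemma] -/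
theorem norm_triPoint_zsmul (n : ℤ) (k : ℤ × ℤ) : ‖triPoint (n • k)‖ = |(n : ℝ)| * ‖triPoint k‖ := by
  rw [map_zsmul, norm_zsmul ℝ, Real.norm_eq_abs]


/-! ### The six units and the rotations `rotN` -/

/-- The six units `ω^j` of `ℤ[ω]` in labels, indexed like `Theil2006.rotN`:
`1, ω, ω², −1, −ω, −ω²`. [cite: Theil2006, §2.3 (21) (preprint p. 8); our lemma] -/
def unitVec : Fin 6 → ℤ × ℤ
  | 0 => (1, 0)
  | 1 => (0, 1)
  | 2 => (-1, 1)
  | 3 => (-1, 0)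
  | 4 => (0, -1)
  | 5 => (1, -1)

/-- **`rotN j` is multiplication by the unit `ω^j`.** [cite: Theil2006, §2.3 (21) (preprint p. 8); our lemma] -/
theorem rotN_eq_emul (j : Fin 6) (k : ℤ × ℤ) : rotN j k = emul (unitVec j) k := by
  obtain ⟨a, b⟩ := k
  (fin_cases j <;> simp [rotN, unitVec, emul]); ring

/-- The units have norm form `1`. [cite: Theil2006, §2.3 (21) (preprint p. 8); our lemma] -/
theorem normForm_unitVec (j : Fin 6) : normForm (unitVec j) = 1 := by
  fin_cases j <;> simp [unitVec, normForm]

/-- The units are the elements of `Theil2006.unitShell`. [cite: Theil2006, §2.3 (21) (preprint p. 8); our lemma] -/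
theorem unitVec_mem_unitShell (j : Fin 6) : unitVec j ∈ unitShell := by
  fin_cases j <;> simp [unitVec, unitShell]

/-- Every element of the unit shell is one of the six units. [cite: Theil2006, §2.3 (21) (preprint p. 8); our lemma] -/
theorem exists_unitVec_eq_of_mem_unitShell {u : ℤ × ℤ} (hu : u ∈ unitShell) : ∃ j, unitVec j = u := by
  simp only [unitShell, Finset.mem_insert, Finset.mem_singleton] at hu
  rcases hu with rfl | rfl | rfl | rfl | rfl | rfl
  · exact ⟨0, rfl⟩
  · exact ⟨1, rfl⟩
  · exact ⟨3, rfl⟩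
  · exact ⟨4, rfl⟩
  · exact ⟨5, rfl⟩
  · exact ⟨2, rfl⟩

/-- **Norm form `1` characterises the units.** [cite: Theil2006, §2.3 (21) (preprint p. 8); our lemma] -/
theorem exists_unitVec_eq_of_normForm_eq_one {u : ℤ × ℤ} (hu : normForm u = 1) : ∃ j, unitVec j = u := by
  have hu0 : u ≠ 0 := by
    intro h; rw [h] at hu; simp [normForm] at hu
  by_cases hmem : u ∈ unitShell
  · exact exists_unitVec_eq_of_mem_unitShell hmem
  · have h3 := three_le_normForm hu0 hmem
    rw [normForm] at hu
    omega

/-- `|ζ| = 1` characterises the units. [cite: Theil2006, §2.3 (21) (preprint p. 8); our lemma] -/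
theorem exists_unitVec_eq_of_norm_eq_one {u : ℤ × ℤ} (hu : ‖triPoint u‖ = 1) : ∃ j, unitVec j = u := by
  apply exists_unitVec_eq_of_normForm_eq_one
  have h := norm_triPoint_sq_eq_normForm u
  rw [hu, one_pow] at h
  exact_mod_cast h.symm

/-- The inverse of `ω^j` is its conjugate: `ω^j · conj(ω^j) = 1`. [cite: Theil2006, §2.3 (21) (preprint p. 8); our lemma] -/
theorem emul_unitVec_econj (j : Fin 6) : emul (unitVec j) (econj (unitVec j)) = (1, 0) := by
  rw [emul_econj, normForm_unitVec]

/-- `rotN` composes additively (re-derived; private in `Theil2006DistanceSet`). [cite: Theil2006, §2.3 (21) (preprint p. 8); our lemma] -/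
theorem rotN_rotN' (i j : Fin 6) (k : ℤ × ℤ) : rotN i (rotN j k) = rotN (i + j) k := by
  obtain ⟨a, b⟩ := k
  fin_cases i <;> fin_cases j <;> simp [rotN] <;> omega

/-- `rotN 0` is the identity. [cite: Theil2006, §2.3 (21) (preprint p. 8); our lemma] -/
@[simp] theorem rotN_zero' (k : ℤ × ℤ) : rotN 0 k = k := rfl

/-- Every non-zero label has a rotate in the fundamental sector (re-derived; private in
`Theil2006DistanceSet`). [cite: Theil2006, §2.3 (21) (preprint p. 8); our lemma] -/
theorem exists_rotN_mem_sector' {k : ℤ × ℤ} (hk : k ≠ 0) : ∃ j : Fin 6, rotN j k ∈ sector := by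
  obtain ⟨a, b⟩ := k
  have hab : ¬(a = 0 ∧ b = 0) := fun h => hk (by rw [h.1, h.2]; rfl)
  simp only [sector, mem_setOf_eq]
  rcases le_or_gt 1 a with ha | ha <;> rcases le_or_gt 0 b with hb | hb
  · exact ⟨0, by simp [rotN]; omega⟩
  · rcases le_or_gt 0 (a + b) with hab' | hab'
    · exact ⟨1, by simp [rotN]; omega⟩
    · exact ⟨2, by simp [rotN]; omega⟩
  · rcases le_or_gt 1 (a + b) with hab' | hab'
    · exact ⟨5, by simp [rotN]; omega⟩
    · rcases le_or_gt 1 b with hb' | hb'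
      · exact ⟨4, by simp [rotN]; omega⟩
      · exact ⟨3, by simp [rotN]; omega⟩
  · rcases le_or_gt 0 (a + b) with hab' | hab'
    · exact ⟨1, by simp [rotN]; omega⟩
    · rcases lt_or_ge a 0 with ha' | ha'
      · exact ⟨3, by simp [rotN]; omega⟩
      · exact ⟨2, by simp [rotN]; omega⟩

/-- Distinct rotates of the sector are disjoint (re-derived; private in `Theil2006DistanceSet`).
[cite: Theil2006, §2.3 (21) (preprint p. 8); our lemma] -/
theorem rotN_mem_sector_unique' {j : Fin 6} {k : ℤ × ℤ} (hk : k ∈ sector)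
    (hj : rotN j k ∈ sector) : j = 0 := by
  obtain ⟨a, b⟩ := k
  simp only [sector, mem_setOf_eq] at hk
  fin_cases j
  · rfl
  all_goals simp [rotN, sector] at hj; omega

/-! ### The sublattices `η ℤ[ω]` of `A₂` and their index -/

/-- **The sublattice `η·ℤ[ω] ⊂ ℤ²`** spanned by `η` and `R_{π/3} η` (a `D₆`-invariant copy of `A₂`
with lattice parameter `|η|`, cf. (21)), as an additive subgroup of the labels.
[cite: Theil2006, §2.3 (21) (preprint p. 8)] -/
def subl (η : ℤ × ℤ) : AddSubgroup (ℤ × ℤ) := (emulHom η).range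

/-- Membership in `η ℤ[ω]`. [cite: Theil2006, §2.3 (21) (preprint p. 8)] -/
theorem mem_subl {η g : ℤ × ℤ} : g ∈ subl η ↔ ∃ ζ, emul η ζ = g := AddMonoidHom.mem_range

/-- `η ζ ∈ η ℤ[ω]`. [cite: Theil2006, §2.3 (21) (preprint p. 8); our lemma] -/
theorem emul_mem_subl (η ζ : ℤ × ℤ) : emul η ζ ∈ subl η := mem_subl.2 ⟨ζ, rfl⟩

/-- `η ∈ η ℤ[ω]`. [cite: Theil2006, §2.3 (21) (preprint p. 8); our lemma] -/
theorem self_mem_subl (η : ℤ × ℤ) : η ∈ subl η := mem_subl.2 ⟨(1, 0), emul_one η⟩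

/-- The rotates `R^j_{π/3} η` lie in `η ℤ[ω]`. [cite: Theil2006, §2.3 (21) (preprint p. 8); our lemma] -/
theorem rotN_mem_subl (j : Fin 6) (η : ℤ × ℤ) : rotN j η ∈ subl η := by
  rw [rotN_eq_emul, emul_comm]; exact emul_mem_subl η _

/-- Associates span the same sublattice: `(u η) ℤ[ω] = η ℤ[ω]` for a unit `u`. [cite: Theil2006, §2.3 (21) (preprint p. 8); our lemma] -/
theorem subl_emul_unitVec (j : Fin 6) (η : ℤ × ℤ) : subl (emul (unitVec j) η) = subl η := by
  ext g
  simp only [mem_subl]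
  constructor
  · rintro ⟨ζ, rfl⟩
    exact ⟨emul (unitVec j) ζ, by rw [emul_comm (unitVec j) η, emul_assoc, emul_comm]⟩
  · rintro ⟨ζ, rfl⟩
    refine ⟨emul (econj (unitVec j)) ζ, ?_⟩
    rw [emul_comm (unitVec j) η, emul_assoc, ← emul_assoc (unitVec j), emul_unitVec_econj, one_emul]

/-- `(R^j η) ℤ[ω] = η ℤ[ω]`. [cite: Theil2006, §2.3 (21) (preprint p. 8); our lemma] -/
theorem subl_rotN (j : Fin 6) (η : ℤ × ℤ) : subl (rotN j η) = subl η := by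
  rw [rotN_eq_emul, subl_emul_unitVec]

/-- Multiples of `n ∈ ℕ ⊂ ℤ[ω]`: `n ℤ[ω] = nℤ × nℤ`. [cite: Theil2006, §2.3 (21) (preprint p. 8); our lemma] -/
theorem subl_natCast (n : ℕ) :
    subl ((n : ℤ), 0) = (AddSubgroup.zmultiples (n : ℤ)).prod (AddSubgroup.zmultiples (n : ℤ)) := by
  ext g
  rw [mem_subl, AddSubgroup.mem_prod, Int.mem_zmultiples_iff, Int.mem_zmultiples_iff]
  constructor
  · rintro ⟨ζ, rfl⟩
    rw [emul_intCast]
    exact ⟨⟨ζ.1, by simp [mul_comm]⟩, ⟨ζ.2, by simp [mul_comm]⟩⟩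
  · rintro ⟨⟨a, ha⟩, ⟨b, hb⟩⟩
    refine ⟨(a, b), ?_⟩
    rw [emul_intCast]
    ext <;> simp [ha, hb, mul_comm]

/-- `[ℤ² : nℤ × nℤ] = n²`. [cite: Theil2006, §2.3 (21) (preprint p. 8); our lemma] -/
theorem index_subl_natCast (n : ℕ) : (subl ((n : ℤ), 0)).index = n * n := by
  rw [subl_natCast, AddSubgroup.index_prod, Int.index_zmultiples, Int.natAbs_natCast]

/-- Conjugation carries `η ℤ[ω]` to `η̄ ℤ[ω]`. [cite: Theil2006, §2.3 (21) (preprint p. 8); our lemma] -/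
theorem map_econj_subl (η : ℤ × ℤ) :
    (subl η).map (econjEquiv : ℤ × ℤ →+ ℤ × ℤ) = subl (econj η) := by
  ext g
  simp only [AddSubgroup.mem_map, mem_subl]
  constructor
  · rintro ⟨h, ⟨ζ, rfl⟩, rfl⟩
    exact ⟨econj ζ, by rw [← econj_emul]; rfl⟩
  · rintro ⟨ζ, rfl⟩
    refine ⟨emul η (econj ζ), ⟨econj ζ, rfl⟩, ?_⟩
    show econj (emul η (econj ζ)) = emul (econj η) ζ
    rw [econj_emul, econj_econj]

/-- `[ℤ² : η̄ ℤ[ω]] = [ℤ² : η ℤ[ω]]`. [cite: Theil2006, §2.3 (21) (preprint p. 8); our lemma] -/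
theorem index_subl_econj (η : ℤ × ℤ) : (subl (econj η)).index = (subl η).index := by
  rw [← map_econj_subl]
  exact AddSubgroup.index_map_equiv _ econjEquiv

/-- Multiplication by `η` carries `η̄ ℤ[ω]` onto `N(η) ℤ[ω]`. [cite: Theil2006, §2.3 (21) (preprint p. 8); our lemma] -/
theorem map_emulHom_subl_econj (η : ℤ × ℤ) :
    (subl (econj η)).map (emulHom η) = subl (normForm η, 0) := by
  ext g
  simp only [AddSubgroup.mem_map, mem_subl, emulHom_apply]
  constructor
  · rintro ⟨h, ⟨ζ, rfl⟩, rfl⟩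
    exact ⟨ζ, by rw [← emul_assoc, emul_econj]⟩
  · rintro ⟨ζ, rfl⟩
    exact ⟨emul (econj η) ζ, ⟨ζ, rfl⟩, by rw [← emul_assoc, emul_econj]⟩

/-- **The index of `η ℤ[ω]` in `ℤ[ω]` is the norm `N(η) = |η|²`** — "a sub-lattice with
lattice parameter `λ` has index `λ²`", the `λ²` of (21) / (72).  Proof: multiplication by `η` is an
injective endomorphism carrying `η̄ℤ[ω]` onto `N(η)ℤ[ω]`, which has index `N(η)²`; the indices of
`ηℤ[ω]` and `η̄ℤ[ω]` agree. [cite: Theil2006, §2.3 (21) (preprint p. 8); our lemma] -/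
theorem index_subl {η : ℤ × ℤ} (hη : η ≠ 0) : (subl η).index = (normForm η).toNat := by
  have hinj : Function.Injective (emulHom η) := emul_injective hη
  have h := AddSubgroup.index_map_of_injective (H := subl (econj η)) hinj
  rw [map_emulHom_subl_econj, index_subl_econj] at h
  have hrange : (emulHom η).range = subl η := rfl
  rw [hrange] at h
  have hn : ((normForm η).toNat : ℤ) = normForm η := Int.toNat_of_nonneg (normForm_nonneg η)
  have h2 : (subl (normForm η, 0)).index = (normForm η).toNat * (normForm η).toNat := by
    rw [← index_subl_natCast, hn]
  rw [h2] at h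
  exact (Nat.mul_self_inj.1 h.symm)

/-- The quotient `ℤ[ω] / η ℤ[ω]` has `N(η)` elements (`η ≠ 0`). [cite: Theil2006, §2.3 (21) (preprint p. 8); our lemma] -/
theorem card_quotient_subl {η : ℤ × ℤ} (hη : η ≠ 0) :
    Nat.card ((ℤ × ℤ) ⧸ subl η) = (normForm η).toNat := by
  rw [← AddSubgroup.index_eq_card, index_subl hη]

/-- The quotient `ℤ[ω] / η ℤ[ω]` is finite (`η ≠ 0`). [cite: Theil2006, §2.3 (21) (preprint p. 8); our lemma] -/
theorem finite_quotient_subl {η : ℤ × ℤ} (hη : η ≠ 0) : Finite ((ℤ × ℤ) ⧸ subl η) := by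
  apply Nat.finite_of_card_ne_zero
  rw [card_quotient_subl hη]
  have := normForm_pos hη
  omega


/-! ### Representatives of the shells modulo the six units -/

/-- The representative of `η` in the fundamental sector `{k₁ ≥ 1, k₂ ≥ 0}` under the rotations by
multiples of `π/3` (junk `0` at `η = 0`). [cite: Theil2006, §2.3 (21) (preprint p. 8); our lemma] -/
def rep (η : ℤ × ℤ) : ℤ × ℤ :=
  if h : η = 0 then 0 else rotN (Classical.choose (exists_rotN_mem_sector' h)) η

/-- `rep η` is a rotate of `η` lying in the sector. [cite: Theil2006, §2.3 (21) (preprint p. 8); our lemma] -/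
theorem rep_spec {η : ℤ × ℤ} (hη : η ≠ 0) : ∃ j : Fin 6, rep η = rotN j η ∧ rep η ∈ sector := by
  unfold rep
  rw [dif_neg hη]
  exact ⟨_, rfl, Classical.choose_spec (exists_rotN_mem_sector' hη)⟩

/-- Rotates of non-zero labels are non-zero. [cite: Theil2006, §2.3 (21) (preprint p. 8); our lemma] -/
theorem rotN_ne_zero' (j : Fin 6) {k : ℤ × ℤ} (hk : k ≠ 0) : rotN j k ≠ 0 := by
  rw [rotN_eq_emul]
  intro h
  rcases emul_eq_zero_iff.1 h with h1 | h1
  · have := normForm_unitVec j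
    rw [h1] at this
    simp [normForm] at this
  · exact hk h1

/-- `rep` maps the shell `{|η| = λ}` into `shell λ ∩ sector`. [cite: Theil2006, §2.3 (21) (preprint p. 8); our lemma] -/
theorem rep_mem_shell_inter_sector {lam : ℝ} {η : ℤ × ℤ} (hη : η ∈ shell lam) :
    rep η ∈ shell lam ∩ sector := by
  obtain ⟨j, hj, hs⟩ := rep_spec hη.1
  refine ⟨?_, hs⟩
  rw [hj]
  exact ⟨rotN_ne_zero' j hη.1, by rw [norm_triPoint_rotN]; exact hη.2⟩

/-- `rep η` spans the same sublattice as `η`. [cite: Theil2006, §2.3 (21) (preprint p. 8); our lemma] -/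
theorem subl_rep {η : ℤ × ℤ} (hη : η ≠ 0) : subl (rep η) = subl η := by
  obtain ⟨j, hj, -⟩ := rep_spec hη
  rw [hj, subl_rotN]

/-- Sector points are non-zero. [cite: Theil2006, §2.3 (21) (preprint p. 8); our lemma] -/
theorem ne_zero_of_mem_sector {η : ℤ × ℤ} (hη : η ∈ sector) : η ≠ 0 := by
  intro h
  rw [h] at hη
  simp [sector] at hη

/-- The representative of a rotate of a sector point is that point. [cite: Theil2006, §2.3 (21) (preprint p. 8); our lemma] -/
theorem rep_rotN_of_mem_sector {η : ℤ × ℤ} (hη : η ∈ sector) (j : Fin 6) : rep (rotN j η) = η := by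
  have h0 : rotN j η ≠ 0 := rotN_ne_zero' j (ne_zero_of_mem_sector hη)
  obtain ⟨i, hi, hs⟩ := rep_spec h0
  rw [rotN_rotN'] at hi
  rw [hi] at hs ⊢
  rw [rotN_mem_sector_unique' hη hs, rotN_zero']

/-- The representative of a unit multiple of a sector point is that point. [cite: Theil2006, §2.3 (21) (preprint p. 8); our lemma] -/
theorem rep_emul_of_mem_sector {η u : ℤ × ℤ} (hη : η ∈ sector) (hu : normForm u = 1) :
    rep (emul u η) = η := by
  obtain ⟨j, rfl⟩ := exists_unitVec_eq_of_normForm_eq_one hu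
  rw [← rotN_eq_emul]
  exact rep_rotN_of_mem_sector hη j

/-! ### The `m(λ) λ²` classes -/

/-- **The index set of the classes of equilateral lattice triangles of side `λ`**: a sublattice
`η ℤ[ω]`, `η ∈ shell(λ) ∩ sector` (the `m(λ)` "different `D₆`-invariant sub-lattices of `A₂` with
lattice parameter `λ`" of (21)), together with one of its `λ²` cosets.  Every equilateral triangle
of side `λ` with vertices in `A₂` is a unit triangle of the translated lattice (coset) of exactly one
class, and within one class the triangles tile the plane — the content of the "`6 m(λ)` sets
`{η₁, η₂, η₃} ⊂ A₂`" count in the proof of (72). [cite: Theil2006, §2.3 (21) (preprint p. 8);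
Appendix proof of Proposition 2.9 (27), display (72) (p. 25); our bookkeeping] -/
def ClassIdx (lam : ℝ) : Type :=
  Σ η : ↥(shell lam ∩ sector), (ℤ × ℤ) ⧸ subl (η : ℤ × ℤ)

/-- The sublattice generator of a class is non-zero. [cite: Theil2006, §2.3 (21) (preprint p. 8); our lemma] -/
theorem ClassIdx.ne_zero {lam : ℝ} (κ : ClassIdx lam) : (κ.1 : ℤ × ℤ) ≠ 0 := κ.1.2.1.1

/-- The sublattice generator of a class has length `λ`. [cite: Theil2006, §2.3 (21) (preprint p. 8); our lemma] -/
theorem ClassIdx.norm_eq {lam : ℝ} (κ : ClassIdx lam) : ‖triPoint (κ.1 : ℤ × ℤ)‖ = lam := κ.1.2.1.2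

/-- The sublattice generator of a class lies in the sector. [cite: Theil2006, §2.3 (21) (preprint p. 8); our lemma] -/
theorem ClassIdx.mem_sector {lam : ℝ} (κ : ClassIdx lam) : (κ.1 : ℤ × ℤ) ∈ sector := κ.1.2.2

/-- There are finitely many classes. [cite: Theil2006, §2.3 (21) (preprint p. 8); our lemma] -/
instance finite_classIdx (lam : ℝ) : Finite (ClassIdx lam) := by
  haveI : ∀ η : ↥(shell lam ∩ sector), Finite ((ℤ × ℤ) ⧸ subl (η : ℤ × ℤ)) :=
    fun η => finite_quotient_subl η.2.1.1
  unfold ClassIdx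
  infer_instance

/-- **There are exactly `m(λ) λ²` classes** (`m(λ)` sublattices, each of index `λ²`).
[cite: Theil2006, §2.3 (21) (preprint p. 8); Appendix display (72) (p. 25); our lemma] -/
theorem natCard_classIdx (lam : ℝ) : (Nat.card (ClassIdx lam) : ℝ) = m lam * lam ^ 2 := by
  classical
  haveI : ∀ η : ↥(shell lam ∩ sector), Finite ((ℤ × ℤ) ⧸ subl (η : ℤ × ℤ)) :=
    fun η => finite_quotient_subl η.2.1.1
  letI : Fintype ↥(shell lam ∩ sector) := Fintype.ofFinite _
  unfold ClassIdx
  rw [Nat.card_sigma]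
  have h : ∀ η : ↥(shell lam ∩ sector),
      (Nat.card ((ℤ × ℤ) ⧸ subl (η : ℤ × ℤ)) : ℝ) = lam ^ 2 := by
    intro η
    rw [card_quotient_subl η.2.1.1]
    have h1 : (((normForm (η : ℤ × ℤ)).toNat : ℤ) : ℝ) = ((normForm (η : ℤ × ℤ) : ℤ) : ℝ) := by
      rw [Int.toNat_of_nonneg (normForm_nonneg _)]
    have h2 : ‖triPoint (η : ℤ × ℤ)‖ ^ 2 = lam ^ 2 := by rw [η.2.1.2]
    rw [← h2, norm_triPoint_sq_eq_normForm]
    exact_mod_cast h1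
  push_cast
  rw [Finset.sum_congr rfl fun η _ => h η, Finset.sum_const, Finset.card_univ, nsmul_eq_mul,
    m_eq_card_sector, Nat.card_eq_fintype_card]

variable {lam : ℝ}

/-- **The coset of labels of a class** (a translate of the sublattice `η ℤ[ω]`).
[cite: Theil2006, Appendix display (72) (preprint p. 25); our bookkeeping] -/
def cosetOf (κ : ClassIdx lam) : Set (ℤ × ℤ) :=
  {g | (QuotientAddGroup.mk g : (ℤ × ℤ) ⧸ subl (κ.1 : ℤ × ℤ)) = κ.2}

/-- Membership in the coset of a class. [cite: Theil2006, §2.3 (21) (preprint p. 8); our lemma] -/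
theorem mem_cosetOf {κ : ClassIdx lam} {g : ℤ × ℤ} :
    g ∈ cosetOf κ ↔ (QuotientAddGroup.mk g : (ℤ × ℤ) ⧸ subl (κ.1 : ℤ × ℤ)) = κ.2 := Iff.rfl

/-- Every coset is non-empty. [cite: Theil2006, §2.3 (21) (preprint p. 8); our lemma] -/
theorem cosetOf_nonempty (κ : ClassIdx lam) : (cosetOf κ).Nonempty := by
  obtain ⟨g, hg⟩ := QuotientAddGroup.mk_surjective κ.2
  exact ⟨g, hg⟩

/-- Two labels of one coset differ by an element of the sublattice. [cite: Theil2006, §2.3 (21) (preprint p. 8); our lemma] -/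
theorem sub_mem_subl_of_mem_cosetOf {κ : ClassIdx lam} {g g' : ℤ × ℤ} (hg : g ∈ cosetOf κ)
    (hg' : g' ∈ cosetOf κ) : g - g' ∈ subl (κ.1 : ℤ × ℤ) := by
  rw [mem_cosetOf] at hg hg'
  have h : (QuotientAddGroup.mk g' : (ℤ × ℤ) ⧸ subl (κ.1 : ℤ × ℤ)) = QuotientAddGroup.mk g := by
    rw [hg, hg']
  rw [QuotientAddGroup.eq] at h
  rwa [neg_add_eq_sub] at h

/-- Translating a label of a coset by a sublattice vector stays in the coset. [cite: Theil2006, §2.3 (21) (preprint p. 8); our lemma] -/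
theorem add_mem_cosetOf {κ : ClassIdx lam} {g ζ : ℤ × ℤ} (hg : g ∈ cosetOf κ)
    (hζ : ζ ∈ subl (κ.1 : ℤ × ℤ)) : g + ζ ∈ cosetOf κ := by
  rw [mem_cosetOf] at hg ⊢
  rw [← hg, eq_comm, QuotientAddGroup.eq]
  have : -g + (g + ζ) = ζ := by abel
  rw [this]
  exact hζ

/-- Two labels of one coset differ by `η ζ`, `ζ ∈ ℤ[ω]`. [cite: Theil2006, §2.3 (21) (preprint p. 8); our lemma] -/
theorem exists_emul_eq_sub {κ : ClassIdx lam} {g g' : ℤ × ℤ} (hg : g ∈ cosetOf κ)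
    (hg' : g' ∈ cosetOf κ) : ∃ ζ, emul (κ.1 : ℤ × ℤ) ζ = g - g' :=
  mem_subl.1 (sub_mem_subl_of_mem_cosetOf hg hg')

/-- **Distances inside a coset are `λ |ζ|`, `ζ ∈ ℤ[ω]`**: hence `0`, `λ`, or `≥ √3 λ`.
[cite: Theil2006, §2.3 (21) (preprint p. 8); our lemma] -/
theorem dist_trichotomy {κ : ClassIdx lam} {g g' : ℤ × ℤ} (hg : g ∈ cosetOf κ) (hg' : g' ∈ cosetOf κ) :
    g = g' ∨ dist (triPoint g) (triPoint g') = lam ∨ √3 * lam ≤ dist (triPoint g) (triPoint g') := by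
  obtain ⟨ζ, hζ⟩ := exists_emul_eq_sub hg hg'
  have hd : dist (triPoint g) (triPoint g') = lam * ‖triPoint ζ‖ := by
    rw [dist_triPoint, ← hζ, norm_triPoint_emul, κ.norm_eq]
  by_cases h0 : ζ = 0
  · left
    rw [h0, emul_zero] at hζ
    exact (sub_eq_zero.1 hζ.symm)
  by_cases hu : ζ ∈ unitShell
  · right; left
    rw [hd, norm_triPoint_of_mem_unitShell hu, mul_one]
  · right; right
    rw [hd]
    have h3 := sqrt_three_le_norm_triPoint h0 hu
    have hlam : 0 ≤ lam := by rw [← κ.norm_eq]; exact norm_nonneg _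
    nlinarith

/-- Distinct labels of one coset are at distance `≥ λ`. [cite: Theil2006, §2.3 (21) (preprint p. 8); our lemma] -/
theorem le_dist_of_mem_cosetOf {κ : ClassIdx lam} {g g' : ℤ × ℤ} (hg : g ∈ cosetOf κ)
    (hg' : g' ∈ cosetOf κ) (hne : g ≠ g') : lam ≤ dist (triPoint g) (triPoint g') := by
  rcases dist_trichotomy hg hg' with h | h | h
  · exact absurd h hne
  · exact h.ge
  · have hlam : 0 ≤ lam := by rw [← κ.norm_eq]; exact norm_nonneg _
    have h3 : (1 : ℝ) ≤ √3 := by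
      rw [show (1 : ℝ) = √1 by simp]
      exact Real.sqrt_le_sqrt (by norm_num)
    nlinarith

/-- Labels of one coset at distance `< √3 λ` coincide or are at distance exactly `λ`. [cite: Theil2006, §2.3 (21) (preprint p. 8); our lemma] -/
theorem dist_eq_of_dist_lt {κ : ClassIdx lam} {g g' : ℤ × ℤ} (hg : g ∈ cosetOf κ)
    (hg' : g' ∈ cosetOf κ) (hne : g ≠ g') (hlt : dist (triPoint g) (triPoint g') < √3 * lam) :
    dist (triPoint g) (triPoint g') = lam := by
  rcases dist_trichotomy hg hg' with h | h | h
  · exact absurd h hne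
  · exact h
  · exact absurd hlt (not_lt.2 h)

/-- The six neighbours `g + R^j_{π/3} η` of a coset label lie in the coset. [cite: Theil2006, §2.3 (21) (preprint p. 8); our lemma] -/
theorem add_rotN_mem_cosetOf {κ : ClassIdx lam} {g : ℤ × ℤ} (hg : g ∈ cosetOf κ) (j : Fin 6) :
    g + rotN j (κ.1 : ℤ × ℤ) ∈ cosetOf κ :=
  add_mem_cosetOf hg (rotN_mem_subl j _)

/-- The six neighbours are at distance `λ`. [cite: Theil2006, §2.3 (21) (preprint p. 8); our lemma] -/
theorem dist_add_rotN (κ : ClassIdx lam) (g : ℤ × ℤ) (j : Fin 6) :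
    dist (triPoint (g + rotN j (κ.1 : ℤ × ℤ))) (triPoint g) = lam := by
  rw [dist_triPoint, add_sub_cancel_left, norm_triPoint_rotN, κ.norm_eq]

/-- The six neighbours are pairwise distinct. [cite: Theil2006, §2.3 (21) (preprint p. 8); our lemma] -/
theorem add_rotN_injective (κ : ClassIdx lam) (g : ℤ × ℤ) :
    Function.Injective fun j : Fin 6 => g + rotN j (κ.1 : ℤ × ℤ) := by
  intro i j h
  have h1 : rotN i (κ.1 : ℤ × ℤ) = rotN j (κ.1 : ℤ × ℤ) := add_left_cancel h
  rw [rotN_eq_emul, rotN_eq_emul, emul_comm, emul_comm (unitVec j)] at h1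
  have h2 := emul_injective κ.ne_zero h1
  revert h2
  fin_cases i <;> fin_cases j <;> simp [unitVec]

/-- A coset label at distance exactly `λ` is one of the six neighbours. [cite: Theil2006, §2.3 (21) (preprint p. 8); our lemma] -/
theorem exists_eq_add_rotN {κ : ClassIdx lam} {g g' : ℤ × ℤ} (hg : g ∈ cosetOf κ)
    (hg' : g' ∈ cosetOf κ) (hd : dist (triPoint g') (triPoint g) = lam) :
    ∃ j : Fin 6, g' = g + rotN j (κ.1 : ℤ × ℤ) := by
  obtain ⟨ζ, hζ⟩ := exists_emul_eq_sub hg' hg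
  have hlam : 0 < lam := by
    rw [← κ.norm_eq]
    exact lt_of_lt_of_le zero_lt_one (one_le_norm_triPoint κ.ne_zero)
  have h1 : ‖triPoint ζ‖ = 1 := by
    have h2 : dist (triPoint g') (triPoint g) = lam * ‖triPoint ζ‖ := by
      rw [dist_triPoint, ← hζ, norm_triPoint_emul, κ.norm_eq]
    rw [hd] at h2
    field_simp at h2
    linarith
  obtain ⟨j, hj⟩ := exists_unitVec_eq_of_norm_eq_one h1
  refine ⟨j, ?_⟩
  rw [rotN_eq_emul, emul_comm, hj, hζ]
  abel

/-! ### The class of an equilateral lattice triangle -/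

/-- **The class of an oriented lattice edge `(g₁, g₂)` of length `λ`**: the sublattice
representative `rep (g₂ − g₁)` and the coset of `g₁`. [cite: Theil2006, Appendix display (72)
(preprint p. 25); our bookkeeping] -/
def classOf {g₁ g₂ : ℤ × ℤ} (h : g₂ - g₁ ∈ shell lam) : ClassIdx lam :=
  ⟨⟨rep (g₂ - g₁), rep_mem_shell_inter_sector h⟩,
    (QuotientAddGroup.mk g₁ : (ℤ × ℤ) ⧸ subl (rep (g₂ - g₁)))⟩

/-- The sublattice of the class of `(g₁, g₂)` is `(g₂ − g₁) ℤ[ω]`. [cite: Theil2006, §2.3 (21) (preprint p. 8); our lemma] -/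
theorem subl_classOf {g₁ g₂ : ℤ × ℤ} (h : g₂ - g₁ ∈ shell lam) :
    subl ((classOf h).1 : ℤ × ℤ) = subl (g₂ - g₁) :=
  subl_rep h.1

/-- The first vertex lies in the coset of the class. [cite: Theil2006, §2.3 (21) (preprint p. 8); our lemma] -/
theorem left_mem_cosetOf_classOf {g₁ g₂ : ℤ × ℤ} (h : g₂ - g₁ ∈ shell lam) :
    g₁ ∈ cosetOf (classOf h) := rfl

/-- The second vertex lies in the coset of the class. [cite: Theil2006, §2.3 (21) (preprint p. 8); our lemma] -/
theorem right_mem_cosetOf_classOf {g₁ g₂ : ℤ × ℤ} (h : g₂ - g₁ ∈ shell lam) :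
    g₂ ∈ cosetOf (classOf h) := by
  have key := add_mem_cosetOf (left_mem_cosetOf_classOf h)
    (show g₂ - g₁ ∈ subl ((classOf h).1 : ℤ × ℤ) by rw [subl_classOf]; exact self_mem_subl _)
  rwa [add_sub_cancel] at key

/-- **The third vertex of an equilateral lattice triangle**: if `|u| = |v| = |v − u| ≠ 0` in `A₂`
then `v = R_{±π/3} u`. [cite: Theil2006, §2.3 (21) (preprint p. 8); our lemma] -/
theorem eq_rotN_of_normForm_eq {u v : ℤ × ℤ} (huv : normForm v = normForm u)
    (hvu : normForm (v - u) = normForm u) (h0 : u ≠ 0) : v = rotN 1 u ∨ v = rotN 5 u := by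
  have hn : normForm u ≠ 0 := fun h => h0 (normForm_eq_zero_iff.1 h)
  obtain ⟨u₁, u₂⟩ := u
  obtain ⟨v₁, v₂⟩ := v
  simp only [normForm, Prod.fst_sub, Prod.snd_sub] at huv hvu hn
  simp only [rotN, Prod.mk.injEq]
  -- the inner product `B = n` and the determinant `s = ± n`
  have hB : 2 * u₁ * v₁ + u₁ * v₂ + u₂ * v₁ + 2 * u₂ * v₂ = u₁ ^ 2 + u₁ * u₂ + u₂ ^ 2 := by
    linear_combination huv - hvu
  have hs : (u₁ * v₂ - u₂ * v₁) ^ 2 = (u₁ ^ 2 + u₁ * u₂ + u₂ ^ 2) ^ 2 := by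
    have hid : (2 * u₁ * v₁ + u₁ * v₂ + u₂ * v₁ + 2 * u₂ * v₂) ^ 2 + 3 * (u₁ * v₂ - u₂ * v₁) ^ 2 =
        4 * (u₁ ^ 2 + u₁ * u₂ + u₂ ^ 2) * (v₁ ^ 2 + v₁ * v₂ + v₂ ^ 2) := by ring
    rw [hB, huv] at hid
    have h3 : (3 : ℤ) * (u₁ * v₂ - u₂ * v₁) ^ 2 = 3 * (u₁ ^ 2 + u₁ * u₂ + u₂ ^ 2) ^ 2 := by
      linear_combination hid
    exact mul_left_cancel₀ (by norm_num : (3 : ℤ) ≠ 0) h3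
  rw [sq_eq_sq_iff_eq_or_eq_neg] at hs
  have h2n : (2 : ℤ) * (u₁ ^ 2 + u₁ * u₂ + u₂ ^ 2) ≠ 0 := mul_ne_zero two_ne_zero hn
  rcases hs with hs | hs
  · left
    constructor
    · apply mul_left_cancel₀ h2n
      linear_combination u₁ * hB - (u₁ + 2 * u₂) * hs
    · apply mul_left_cancel₀ h2n
      linear_combination u₂ * hB + (2 * u₁ + u₂) * hs
  · right
    constructor
    · apply mul_left_cancel₀ h2n
      linear_combination u₁ * hB - (u₁ + 2 * u₂) * hs
    · apply mul_left_cancel₀ h2n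
      linear_combination u₂ * hB + (2 * u₁ + u₂) * hs

/-- Equal lengths in `A₂` means equal norm forms. [cite: Theil2006, §2.3 (21) (preprint p. 8); our lemma] -/
theorem normForm_eq_of_norm_eq {a b : ℤ × ℤ} (h : ‖triPoint a‖ = ‖triPoint b‖) :
    normForm a = normForm b := by
  have h2 : (normForm a : ℝ) = normForm b := by
    rw [← norm_triPoint_sq_eq_normForm, ← norm_triPoint_sq_eq_normForm, h]
  exact_mod_cast h2

/-- **The third vertex of an equilateral lattice triangle of side `λ` lies in the class of any of
its edges.** [cite: Theil2006, Appendix display (72) (preprint p. 25); our lemma] -/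
theorem third_mem_cosetOf_classOf {g₁ g₂ g₃ : ℤ × ℤ} (h : g₂ - g₁ ∈ shell lam)
    (h13 : dist (triPoint g₃) (triPoint g₁) = lam) (h23 : dist (triPoint g₃) (triPoint g₂) = lam) :
    g₃ ∈ cosetOf (classOf h) := by
  have huv : normForm (g₃ - g₁) = normForm (g₂ - g₁) :=
    normForm_eq_of_norm_eq (by rw [← dist_triPoint, h13, h.2])
  have hvu : normForm ((g₃ - g₁) - (g₂ - g₁)) = normForm (g₂ - g₁) := by
    rw [show (g₃ - g₁) - (g₂ - g₁) = g₃ - g₂ by abel]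
    exact normForm_eq_of_norm_eq (by rw [← dist_triPoint, h23, h.2])
  have hmem : ∀ j : Fin 6, g₁ + rotN j (g₂ - g₁) ∈ cosetOf (classOf h) := fun j =>
    add_mem_cosetOf (left_mem_cosetOf_classOf h)
      (show rotN j (g₂ - g₁) ∈ subl ((classOf h).1 : ℤ × ℤ) by
        rw [subl_classOf]; exact rotN_mem_subl j _)
  rcases eq_rotN_of_normForm_eq huv hvu h.1 with h3 | h3
  · have : g₃ = g₁ + rotN 1 (g₂ - g₁) := by rw [← h3]; abel
    rw [this]; exact hmem 1
  · have : g₃ = g₁ + rotN 5 (g₂ - g₁) := by rw [← h3]; abel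
    rw [this]; exact hmem 5

/-- **Different classes share no lattice edge of length `λ`**: if two labels at distance `λ` both lie
in the cosets of `κ` and `κ′` then `κ = κ′`. [cite: Theil2006, Appendix display (72) (preprint
p. 25); our lemma] -/
theorem classIdx_eq_of_edge {κ κ' : ClassIdx lam} {g₁ g₂ : ℤ × ℤ} (h1 : g₁ ∈ cosetOf κ)
    (h2 : g₂ ∈ cosetOf κ) (h1' : g₁ ∈ cosetOf κ') (h2' : g₂ ∈ cosetOf κ')
    (hd : dist (triPoint g₂) (triPoint g₁) = lam) : κ = κ' := by
  obtain ⟨j, hj⟩ := exists_eq_add_rotN h1 h2 hd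
  obtain ⟨j', hj'⟩ := exists_eq_add_rotN h1' h2' hd
  have he : rotN j (κ.1 : ℤ × ℤ) = rotN j' (κ'.1 : ℤ × ℤ) := by
    have := hj.symm.trans hj'
    exact add_left_cancel this
  have hη : (κ.1 : ℤ × ℤ) = (κ'.1 : ℤ × ℤ) := by
    rw [← rep_rotN_of_mem_sector κ.mem_sector j, he, rep_rotN_of_mem_sector κ'.mem_sector j']
  obtain ⟨⟨η, hη0⟩, q⟩ := κ
  obtain ⟨⟨η', hη0'⟩, q'⟩ := κ'
  simp only at hη
  subst hη
  rw [mem_cosetOf] at h1 h1'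
  simp only at h1 h1'
  rw [← h1, ← h1']

/-! ### Every coset is `λ`-dense -/

/-- Rounding an integer to the nearest multiple of `n > 0`: `|n q − t| ≤ n/2`. [cite: Theil2006, §2.3 (21) (preprint p. 8); our lemma] -/
theorem exists_round_div {n : ℤ} (hn : 0 < n) (t : ℤ) : ∃ q : ℤ, 2 * |n * q - t| ≤ n := by
  refine ⟨(2 * t + n) / (2 * n), ?_⟩
  have h1 := Int.emod_add_mul_ediv (2 * t + n) (2 * n)
  have h2 := Int.emod_nonneg (2 * t + n) (show (2 * n : ℤ) ≠ 0 by omega)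
  have h3 := Int.emod_lt_of_pos (2 * t + n) (show (0 : ℤ) < 2 * n by omega)
  have h4 : 2 * (n * ((2 * t + n) / (2 * n)) - t) = n - (2 * t + n) % (2 * n) := by linarith
  have h5 : |2 * (n * ((2 * t + n) / (2 * n)) - t)| ≤ n := by
    rw [h4, abs_le]; constructor <;> linarith
  rwa [abs_mul, abs_two] at h5

/-- **Every coset of every class has a label within `λ` of any given label** (the covering radius of
the translated lattice `ξ + η ℤ[ω]` is `|η|/√3 < |η|`; here by rounding in the basis `η, ωη`).
[cite: Theil2006, Appendix display (72) (preprint p. 25); our lemma] -/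
theorem exists_mem_cosetOf_dist_lt (κ : ClassIdx lam) (p : ℤ × ℤ) :
    ∃ g ∈ cosetOf κ, dist (triPoint g) (triPoint p) < lam := by
  obtain ⟨g₀, hg₀⟩ := cosetOf_nonempty κ
  set η : ℤ × ℤ := (κ.1 : ℤ × ℤ) with hη
  set n : ℤ := normForm η with hn
  have hn0 : 0 < n := normForm_pos κ.ne_zero
  set t : ℤ × ℤ := emul (econj η) (p - g₀) with ht
  obtain ⟨q₁, hq₁⟩ := exists_round_div hn0 t.1
  obtain ⟨q₂, hq₂⟩ := exists_round_div hn0 t.2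
  set q : ℤ × ℤ := (q₁, q₂) with hq
  set e : ℤ × ℤ := n • q - t with he
  refine ⟨g₀ + emul η q, add_mem_cosetOf hg₀ (emul_mem_subl η q), ?_⟩
  -- `n (g − p) = η e`
  have key : n • (g₀ + emul η q - p) = emul η e := by
    rw [he, emul_sub, emul_zsmul, ht, ← emul_assoc, emul_econj, ← hn, emul_intCast, smul_sub,
      smul_add, smul_sub]
    abel
  -- `|e|² ≤ 3n²/4 < n²`
  have he1 : 2 * |e.1| ≤ n := by rw [he]; simpa using hq₁
  have he2 : 2 * |e.2| ≤ n := by rw [he]; simpa using hq₂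
  have hne : normForm e < n ^ 2 := by
    rw [normForm]
    have h1 : 4 * e.1 ^ 2 ≤ n ^ 2 := by nlinarith [abs_nonneg e.1, sq_abs e.1]
    have h2 : 4 * e.2 ^ 2 ≤ n ^ 2 := by nlinarith [abs_nonneg e.2, sq_abs e.2]
    nlinarith [sq_nonneg (e.1 - e.2)]
  have hne' : ‖triPoint e‖ < n := by
    have h1 : ‖triPoint e‖ ^ 2 < (n : ℝ) ^ 2 := by
      rw [norm_triPoint_sq_eq_normForm]; exact_mod_cast hne
    have hn' : (0 : ℝ) ≤ n := by exact_mod_cast hn0.le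
    nlinarith [norm_nonneg (triPoint e)]
  have hlam : 0 < lam := by
    rw [← κ.norm_eq]
    exact lt_of_lt_of_le zero_lt_one (one_le_norm_triPoint κ.ne_zero)
  have hnR : (0 : ℝ) < n := by exact_mod_cast hn0
  have h : ‖triPoint (n • (g₀ + emul η q - p))‖ = ‖triPoint (emul η e)‖ := by rw [key]
  rw [norm_triPoint_zsmul, norm_triPoint_emul, abs_of_pos hnR] at h
  have hηn : ‖triPoint η‖ = lam := by rw [hη]; exact κ.norm_eq
  rw [hηn] at h
  rw [dist_triPoint]
  nlinarith

end Theil2006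

end Literature.MathematicalPhysics.StatisticalMechanics
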